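import Literature.NumberTheory.LFunctions.DirichletLZeroCountingCentralSlope
import Literature.NumberTheory.LFunctions.DirichletArgSBound
import Literature.NumberTheory.LFunctions.WeilExplicitArchParitySech
import Literature.NumberTheory.LFunctions.RiemannSiegelThetaBounds
import Literature.NumberTheory.LFunctions.RiemannSiegelStirling
import Mathlib.Analysis.SpecialFunctions.Trigonometric.Bounds
import Mathlib.Analysis.SpecialFunctions.Trigonometric.ArctanDeriv
import Mathlib.Analysis.SpecialFunctions.Trigonometric.DerivHyp
import HarnessLib

/-!
# The parity profile of `N(T, χ)`: `θ₁(T) − θ₀(T) = ½ arctan(sinh πT)` (MV Theorem 14.5 / Corollary 14.6)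

Topic `Literature/NumberTheory/LFunctions`, vocabulary of `DirichletLZeroCounting.lean` (Montgomery–Vaughan
Theorem 14.5: for a primitive `χ` mod `q ≠ 1` of parity `κ = a_χ ∈ {0, 1}` the two-sided count of the
non-trivial zeros with `|Im ρ| ≤ T` is `N(T, χ) = (2 θ_κ(T) + T log q)/π + S(T, χ) + S(T, χ̄)`,
`θ_κ(T) = gammaArgPhase κ T = ∫₀ᵀ Re (Γ_ℝ'/Γ_ℝ)(½ + κ + iu) du = arg Γ(¼ + κ/2 + iT/2) − (T/2) log π`,
`θ₀ = riemannSiegelTheta`) and sequel of `DirichletLZeroCountingCentralSlope.lean` (the parity law AT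
`T = 0`: the odd main term has slope exactly `1` more than the even one).

Here the parity law is made EXACT AT EVERY HEIGHT.  The two `Γ`-phases differ by an elementary
function:

  `θ₁(T) − θ₀(T) = ½ arctan(sinh πT)`      (`gammaArgPhase_one_sub_zero`),

because `θ_κ'(T) = −½ log π + ½ Re ψ(¼ + κ/2 + iT/2)` and `Re ψ(¾ + iT/2) − Re ψ(¼ + iT/2) = π sech πT`
(the reflection formula for `ψ`, tree `WeilArchParity.re_digamma_par_one_sub_zero`), while
`(d/dT) ½ arctan(sinh πT) = (π/2) sech πT`; both sides vanish at `T = 0`.  Consequently: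

* `0 < θ₁(T) − θ₀(T) < π/4` for `T > 0`, odd in `T`, strictly increasing, `→ π/4` — the EXACT form of the
  parity constant `−χ(−1)/8` of MV Corollary 14.6 («`N(T,χ) = (T/2π) log(qT/2π) − T/2π + S(T,χ) − S(0,χ)
  − χ(−1)/8 + O(1/(T+1))`», one-sided count; two-sided: twice), whose `T → ∞` value
  `θ₁ − θ₀ → π/4` is here an identity at finite `T`;
* the main terms `N_sm(T; q, κ) := (2θ_κ(T) + T log q)/π` satisfy, for EVERY modulus `q` and every `T`,
  `N_sm(T; q, 1) − N_sm(T; q, 0) = arctan(sinh πT)/π` (`zeroCountingMainTerm_odd_sub_even`): `0.3695`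
  at `T = ½`, `0.4725` at `T = 1`, `0.4988` at `T = 2`, limit `½`, slope `1` at `T = 0` (the central-slope
  law of the prequel is its derivative at `0`);
* for two primitive characters `χ₁` odd, `χ₀` even of the same modulus `q ≠ 1` and a common height `T > 0`
  off their ordinates: `N(T, χ₁) − N(T, χ₀) = arctan(sinh πT)/π + [S(T,χ₁) + S(T,χ̄₁)] − [S(T,χ₀) + S(T,χ̄₀)]`
  (`lfunctionZeroCount_odd_sub_even`), hence with the explicit Lemma 12.8 (`DirichletArgSBound`)
  `|N(T, χ₁) − N(T, χ₀) − arctan(sinh πT)/π| ≤ 10 + 4 log(2q(T+4)ζ(5/4))/log(7/6)`;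
* every explicit Stirling bound of the tree for `θ₀ = θ` (`RiemannSiegelThetaBounds`) transfers to the
  odd phase `θ₁` with the bounded correction `½ arctan(sinh πT) ∈ [0, π/4)`
  (`abs_gammaArgPhase_one_sub_stirlingMain_le`).

Everything is PROVED; no named facts.  (Cell `rh-explicit`, GRH arm: the closed form behind the
odd/even columns of `HOME/rh-explicit-weil-grh-5/PARITY-LOWZEROS.md`, whose numerically integrated
main-term differences `0.472` (`T₀ = 1`), `0.499` (`T₀ = 2`), `0.500` (`T₀ = 5`) are `arctan(sinh πT₀)/π`.)

## References
* H. L. Montgomery, R. C. Vaughan, *Multiplicative Number Theory I*, CUP 2007: Theorem 14.5 (p. 454) and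
  Corollary 14.6 (pp. 455–456, the constant `−χ(−1)/8`). [MontgomeryVaughan2007]
* G. E. Andrews, R. Askey, R. Roy, *Special Functions*, CUP 1999, (1.2.15) (reflection formula for `ψ`,
  behind `re_digamma_par_one_sub_zero`). [AndrewsAskeyRoy1999]
-/

open Complex Real MeasureTheory Filter Set intervalIntegral

namespace Literature.NumberTheory.LFunctions

namespace DirichletTheta

open Literature.Analysis.SpecialFunctions.Complex WeilArchParity ExplicitPsiChar DirichletDisc

/-! ### The derivative of `θ_κ` in digamma form -/

/-- `(½ + κ + iT)/2` is not a pole of `ψ`: its real part is positive. [folklore] -/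
private theorem half_add_nat_add_mul_I_div_two_ne_neg_nat (κ : ℕ) (T : ℝ) (m : ℕ) :
    ((1 / 2 : ℂ) + κ + T * I) / 2 ≠ -m := by
  intro h
  have h1 := congrArg Complex.re h
  simp only [Complex.div_ofNat_re, Complex.add_re, Complex.mul_re, Complex.ofReal_re, Complex.I_re,
    mul_zero, Complex.ofReal_im, Complex.I_im, mul_one, sub_self, add_zero, Complex.natCast_re,
    Complex.neg_re, Complex.one_re] at h1
  norm_num at h1
  have : (0 : ℝ) ≤ κ := Nat.cast_nonneg κ
  have : (0 : ℝ) ≤ m := Nat.cast_nonneg m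
  linarith

/-- **`θ_κ'(T) = Re (Γ_ℝ'/Γ_ℝ)(½ + κ + iT) = −½ log π + ½ Re ψ(¼ + κ/2 + iT/2)`** (`Γ_ℝ(s) = π^{−s/2}Γ(s/2)`).
[cite: MontgomeryVaughan2007, Theorem 14.5 with (10.30)/(C.10)] -/
theorem re_logDeriv_Gammaℝ_line_eq_digamma (κ : ℕ) (T : ℝ) :
    (logDeriv Gammaℝ (1 / 2 + κ + T * I)).re =
      -Real.log Real.pi / 2 + (Complex.digamma (1 / 4 + (κ : ℂ) / 2 + T / 2 * I)).re / 2 := by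
  rw [Literature.NumberTheory.LFunctions.logDeriv_Gammaℝ (half_add_nat_add_mul_I_div_two_ne_neg_nat κ T)]
  have e : ((1 / 2 : ℂ) + κ + T * I) / 2 = 1 / 4 + (κ : ℂ) / 2 + T / 2 * I := by ring
  rw [e]
  have hlog : (Complex.log Real.pi).re = Real.log Real.pi := by
    rw [Complex.log_re, Complex.norm_real, Real.norm_eq_abs, abs_of_pos Real.pi_pos]
  simp [Complex.add_re, Complex.neg_re, Complex.div_ofNat_re, hlog]

/-- **The two `Γ`-phase densities differ by `(π/2) sech πT`**:
`Re (Γ_ℝ'/Γ_ℝ)(3/2 + iT) − Re (Γ_ℝ'/Γ_ℝ)(½ + iT) = ½ (Re ψ(¾ + iT/2) − Re ψ(¼ + iT/2)) = π/(2 cosh πT)`.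
[cite: MontgomeryVaughan2007, Theorem 14.5; AndrewsAskeyRoy1999, (1.2.15)] -/
theorem re_logDeriv_Gammaℝ_line_one_sub_zero (T : ℝ) :
    (logDeriv Gammaℝ (1 / 2 + ((1 : ℕ) : ℂ) + T * I)).re - (logDeriv Gammaℝ (1 / 2 + ((0 : ℕ) : ℂ) + T * I)).re =
      Real.pi / (2 * Real.cosh (Real.pi * T)) := by
  rw [re_logDeriv_Gammaℝ_line_eq_digamma 1 T, re_logDeriv_Gammaℝ_line_eq_digamma 0 T]
  have h := re_digamma_par_one_sub_zero T
  have e : Real.pi / (2 * Real.cosh (Real.pi * T)) = (Real.pi / Real.cosh (Real.pi * T)) / 2 := by ring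
  rw [e, ← h]
  ring

/-! ### The closed form -/

/-- `(d/dT) [θ₁(T) − θ₀(T)] = π/(2 cosh πT)`. [cite: MontgomeryVaughan2007, Theorem 14.5] -/
theorem hasDerivAt_gammaArgPhase_one_sub_zero (T : ℝ) :
    HasDerivAt (fun T : ℝ ↦ gammaArgPhase 1 T - gammaArgPhase 0 T)
      (Real.pi / (2 * Real.cosh (Real.pi * T))) T := by
  have h := (hasDerivAt_gammaArgPhase 1 T).sub (hasDerivAt_gammaArgPhase 0 T)
  rwa [re_logDeriv_Gammaℝ_line_one_sub_zero] at h

/-- `(d/dT) ½ arctan(sinh πT) = π/(2 cosh πT)` (`1 + sinh² = cosh²`). [folklore] -/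
private theorem hasDerivAt_half_arctan_sinh (T : ℝ) :
    HasDerivAt (fun T : ℝ ↦ Real.arctan (Real.sinh (Real.pi * T)) / 2)
      (Real.pi / (2 * Real.cosh (Real.pi * T))) T := by
  have h1 : HasDerivAt (fun T : ℝ ↦ Real.pi * T) Real.pi T := by
    simpa using (hasDerivAt_id T).const_mul Real.pi
  have h2 : HasDerivAt (fun T : ℝ ↦ Real.sinh (Real.pi * T)) (Real.cosh (Real.pi * T) * Real.pi) T :=
    (Real.hasDerivAt_sinh (Real.pi * T)).comp T h1
  have h3 := (h2.arctan).div_const 2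
  refine h3.congr_deriv ?_
  have hc : Real.cosh (Real.pi * T) ≠ 0 := (Real.cosh_pos _).ne'
  rw [← Real.cosh_sq']
  field_simp

/-- **THE PARITY PROFILE OF THE `Γ`-PHASE: `θ₁(T) − θ₀(T) = ½ arctan(sinh πT)`** for every real `T`
(both sides have derivative `π/(2 cosh πT)` and vanish at `T = 0`).  Exact form, at finite `T`, of the
parity constant of MV Corollary 14.6 (`θ_κ(T) = (T/2) log(T/2π) − T/2 − π χ(−1)/8 + O(1/(T+1))`, so
`θ₁ − θ₀ → π/4`). [cite: MontgomeryVaughan2007, Theorem 14.5 and Corollary 14.6 (pp. 454–456)] -/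
theorem gammaArgPhase_one_sub_zero (T : ℝ) :
    gammaArgPhase 1 T - gammaArgPhase 0 T = Real.arctan (Real.sinh (Real.pi * T)) / 2 := by
  -- `h := (θ₁ − θ₀) − ½ arctan sinh(π ·)` has derivative `0` everywhere and `h 0 = 0`
  have hd : ∀ x, HasDerivAt (fun T : ℝ ↦ (gammaArgPhase 1 T - gammaArgPhase 0 T) -
      Real.arctan (Real.sinh (Real.pi * T)) / 2) 0 x := by
    intro x
    have := (hasDerivAt_gammaArgPhase_one_sub_zero x).sub (hasDerivAt_half_arctan_sinh x)
    rw [sub_self] at this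
    exact this
  have hdiff : Differentiable ℝ (fun T : ℝ ↦ (gammaArgPhase 1 T - gammaArgPhase 0 T) -
      Real.arctan (Real.sinh (Real.pi * T)) / 2) := fun x ↦ (hd x).differentiableAt
  have hconst := is_const_of_deriv_eq_zero hdiff (fun x ↦ (hd x).deriv) T 0
  have h0 : gammaArgPhase 1 0 - gammaArgPhase 0 0 - Real.arctan (Real.sinh (Real.pi * 0)) / 2 = 0 := by
    simp [gammaArgPhase]
  linarith [hconst, h0]

/-- The same with `θ₀ = θ` (Riemann–Siegel): **`θ₁(T) = θ(T) + ½ arctan(sinh πT)`** — the phase of an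
odd primitive `L(s, χ)` in terms of the Riemann–Siegel theta function.
[cite: MontgomeryVaughan2007, Theorem 14.5 and Corollary 14.6] -/
theorem gammaArgPhase_one_eq_riemannSiegelTheta_add (T : ℝ) :
    gammaArgPhase 1 T = riemannSiegelTheta T + Real.arctan (Real.sinh (Real.pi * T)) / 2 := by
  rw [← gammaArgPhase_zero T]
  linarith [gammaArgPhase_one_sub_zero T]

/-! ### Size, sign, monotonicity, limit of the parity term -/

/-- `|θ₁(T) − θ₀(T)| < π/4` for every `T`. [cite: MontgomeryVaughan2007, Corollary 14.6 (the constant −χ(−1)/8)] -/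
theorem abs_gammaArgPhase_one_sub_zero_lt (T : ℝ) :
    |gammaArgPhase 1 T - gammaArgPhase 0 T| < Real.pi / 4 := by
  rw [gammaArgPhase_one_sub_zero, abs_div, abs_two]
  have h1 := Real.arctan_lt_pi_div_two (Real.sinh (Real.pi * T))
  have h2 := Real.neg_pi_div_two_lt_arctan (Real.sinh (Real.pi * T))
  have : |Real.arctan (Real.sinh (Real.pi * T))| < Real.pi / 2 := abs_lt.2 ⟨h2, h1⟩
  linarith

/-- `0 < θ₁(T) − θ₀(T)` for `T > 0` (and `θ₁ − θ₀` is odd, `gammaArgPhase_neg`): at every positive height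
the odd `Γ`-phase is ahead of the even one. [cite: MontgomeryVaughan2007, Corollary 14.6] -/
theorem gammaArgPhase_one_sub_zero_pos {T : ℝ} (hT : 0 < T) :
    0 < gammaArgPhase 1 T - gammaArgPhase 0 T := by
  rw [gammaArgPhase_one_sub_zero]
  have hs : 0 < Real.sinh (Real.pi * T) := Real.sinh_pos_iff.2 (by positivity)
  have : 0 < Real.arctan (Real.sinh (Real.pi * T)) := by
    rw [← Real.arctan_zero]
    exact Real.arctan_strictMono hs
  linarith

/-- `0 ≤ θ₁(T) − θ₀(T)` for `T ≥ 0`. [cite: MontgomeryVaughan2007, Corollary 14.6] -/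
theorem gammaArgPhase_one_sub_zero_nonneg {T : ℝ} (hT : 0 ≤ T) :
    0 ≤ gammaArgPhase 1 T - gammaArgPhase 0 T := by
  rcases hT.eq_or_lt with h | h
  · rw [← h]; simp [gammaArgPhase]
  · exact (gammaArgPhase_one_sub_zero_pos h).le

/-- `T ↦ θ₁(T) − θ₀(T)` is strictly increasing on `ℝ`. [cite: MontgomeryVaughan2007, Theorem 14.5] -/
theorem strictMono_gammaArgPhase_one_sub_zero :
    StrictMono fun T : ℝ ↦ gammaArgPhase 1 T - gammaArgPhase 0 T := by
  refine strictMono_of_deriv_pos fun x ↦ ?_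
  rw [(hasDerivAt_gammaArgPhase_one_sub_zero x).deriv]
  have := Real.cosh_pos (Real.pi * x)
  positivity

/-- `θ₁(T) − θ₀(T) → π/4` as `T → +∞` (MV Corollary 14.6: `(2κ − 1)π/8` at `κ = 1` minus `κ = 0`).
[cite: MontgomeryVaughan2007, Corollary 14.6 (pp. 455–456)] -/
theorem tendsto_gammaArgPhase_one_sub_zero_atTop :
    Tendsto (fun T : ℝ ↦ gammaArgPhase 1 T - gammaArgPhase 0 T) atTop (nhds (Real.pi / 4)) := by
  simp_rw [gammaArgPhase_one_sub_zero]
  have h1 : Tendsto (fun T : ℝ ↦ Real.pi * T) atTop atTop :=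
    Filter.Tendsto.const_mul_atTop Real.pi_pos tendsto_id
  have h2 : Tendsto (fun T : ℝ ↦ Real.sinh (Real.pi * T)) atTop atTop := by
    refine tendsto_atTop_mono' atTop ?_ h1
    filter_upwards [eventually_ge_atTop (0 : ℝ)] with T hT
    exact Real.self_le_sinh_iff.2 (by positivity)
  have h3 : Tendsto (fun T : ℝ ↦ Real.arctan (Real.sinh (Real.pi * T))) atTop (nhds (Real.pi / 2)) :=
    (Real.tendsto_arctan_atTop.mono_right nhdsWithin_le_nhds).comp h2
  have h4 := h3.div_const 2
  rw [show Real.pi / 2 / 2 = Real.pi / 4 by ring] at h4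
  exact h4

/-! ### The main terms `N_sm(T; q, κ) = (2θ_κ(T) + T log q)/π` -/

/-- **PARITY LAW OF THE MAIN TERM AT EVERY HEIGHT.** For every modulus `q` and every real `T`,
`N_sm(T; q, 1) − N_sm(T; q, 0) = arctan(sinh πT)/π` (`= 0.4725…` at `T = 1`, `0.4988…` at `T = 2`;
limit `½`; derivative `1` at `T = 0` = `deriv_zeroCountingMainTerm_zero_odd_sub_even`).
[cite: MontgomeryVaughan2007, Theorem 14.5 and Corollary 14.6] -/
theorem zeroCountingMainTerm_odd_sub_even (q : ℕ) (T : ℝ) :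
    (2 * gammaArgPhase 1 T + T * Real.log q) / Real.pi - (2 * gammaArgPhase 0 T + T * Real.log q) / Real.pi =
      Real.arctan (Real.sinh (Real.pi * T)) / Real.pi := by
  have h := gammaArgPhase_one_sub_zero T
  rw [div_sub_div_same, show 2 * gammaArgPhase 1 T + T * Real.log q - (2 * gammaArgPhase 0 T + T * Real.log q) =
    2 * (gammaArgPhase 1 T - gammaArgPhase 0 T) by ring, h]
  ring

/-- The main-term parity difference lies in `[0, ½)` for `T ≥ 0`. [cite: MontgomeryVaughan2007, Corollary 14.6] -/
theorem zeroCountingMainTerm_odd_sub_even_mem_Ico (q : ℕ) {T : ℝ} (hT : 0 ≤ T) :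
    (2 * gammaArgPhase 1 T + T * Real.log q) / Real.pi - (2 * gammaArgPhase 0 T + T * Real.log q) / Real.pi ∈
      Ico (0 : ℝ) (1 / 2) := by
  rw [zeroCountingMainTerm_odd_sub_even]
  have hπ := Real.pi_pos
  have hs : 0 ≤ Real.sinh (Real.pi * T) := Real.sinh_nonneg_iff.2 (by positivity)
  have h0 : 0 ≤ Real.arctan (Real.sinh (Real.pi * T)) := by
    rw [← Real.arctan_zero]; exact Real.arctan_strictMono.monotone hs
  have h1 := Real.arctan_lt_pi_div_two (Real.sinh (Real.pi * T))
  constructor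
  · positivity
  · rw [div_lt_iff₀ hπ]; linarith

/-! ### Exact zero counts: an odd and an even primitive character of the same modulus -/

variable {q : ℕ} [NeZero q]

/-- **`N(T, χ₁) − N(T, χ₀)` for `χ₁` odd, `χ₀` even, both primitive mod `q ≠ 1`**, at a common height
`T > 0` which is the ordinate of no zero of either (two-sided counts with multiplicity,
`lfunctionZeroCount`): the `T log q` terms cancel and
`N(T, χ₁) − N(T, χ₀) = arctan(sinh πT)/π + [S(T,χ₁) + S(T,χ̄₁)] − [S(T,χ₀) + S(T,χ̄₀)]`.
[cite: MontgomeryVaughan2007, Theorem 14.5 (two characters of opposite parity)] -/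
theorem lfunctionZeroCount_odd_sub_even {χ₁ χ₀ : DirichletCharacter ℂ q} (hq : q ≠ 1)
    (h₁ : χ₁.IsPrimitive) (h₀ : χ₀.IsPrimitive) (hodd : χ₁.Odd) (heven : χ₀.Even) {T : ℝ} (hT : 0 < T)
    (hT₁ : ∀ ρ ∈ charNontrivialZeros χ₁, ρ.im ≠ T) (hT₁' : ∀ ρ ∈ charNontrivialZeros χ₁, ρ.im ≠ -T)
    (hT₀ : ∀ ρ ∈ charNontrivialZeros χ₀, ρ.im ≠ T) (hT₀' : ∀ ρ ∈ charNontrivialZeros χ₀, ρ.im ≠ -T) :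
    (lfunctionZeroCount χ₁ T : ℝ) - (lfunctionZeroCount χ₀ T : ℝ) =
      Real.arctan (Real.sinh (Real.pi * T)) / Real.pi +
        ((dirichletArgS χ₁ T + dirichletArgS χ₁⁻¹ T) - (dirichletArgS χ₀ T + dirichletArgS χ₀⁻¹ T)) := by
  have hπ : Real.pi ≠ 0 := Real.pi_ne_zero
  have e₁ := pi_mul_lfunctionZeroCount_eq h₁ hq hT hT₁ hT₁'
  have e₀ := pi_mul_lfunctionZeroCount_eq h₀ hq hT hT₀ hT₀'
  rw [charParity_of_odd hodd] at e₁
  rw [charParity_of_even heven] at e₀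
  have h := gammaArgPhase_one_sub_zero T
  field_simp
  linear_combination e₁ - e₀ + 2 * h

/-- **Explicit bracket**: with the tree's explicit MV Lemma 12.8 (`abs_dirichletArgS_le`:
`|S(T, χ)| ≤ 5/2 + log(2q(|T|+4)ζ(5/4))/log(7/6)`),
`|N(T, χ₁) − N(T, χ₀) − arctan(sinh πT)/π| ≤ 10 + 4 log(2q(T+4)ζ(5/4))/log(7/6)`.
[cite: MontgomeryVaughan2007, Theorem 14.5 with Lemma 12.8 and Corollary 14.7] -/
theorem abs_lfunctionZeroCount_odd_sub_even_sub_le {χ₁ χ₀ : DirichletCharacter ℂ q} (hq : q ≠ 1)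
    (h₁ : χ₁.IsPrimitive) (h₀ : χ₀.IsPrimitive) (hodd : χ₁.Odd) (heven : χ₀.Even) {T : ℝ} (hT : 0 < T)
    (hT₁ : ∀ ρ ∈ charNontrivialZeros χ₁, ρ.im ≠ T) (hT₁' : ∀ ρ ∈ charNontrivialZeros χ₁, ρ.im ≠ -T)
    (hT₀ : ∀ ρ ∈ charNontrivialZeros χ₀, ρ.im ≠ T) (hT₀' : ∀ ρ ∈ charNontrivialZeros χ₀, ρ.im ≠ -T) :
    |(lfunctionZeroCount χ₁ T : ℝ) - (lfunctionZeroCount χ₀ T : ℝ) - Real.arctan (Real.sinh (Real.pi * T)) / Real.pi| ≤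
      10 + 4 * (Real.log (2 * (q * (T + 4) * Zc)) / Real.log (7 / 6)) := by
  have a₁ := abs_lfunctionZeroCount_sub_le h₁ hq hT hT₁ hT₁'
  have a₀ := abs_lfunctionZeroCount_sub_le h₀ hq hT hT₀ hT₀'
  rw [charParity_of_odd hodd] at a₁
  rw [charParity_of_even heven] at a₀
  have hm := zeroCountingMainTerm_odd_sub_even q T
  have key : (lfunctionZeroCount χ₁ T : ℝ) - (lfunctionZeroCount χ₀ T : ℝ) -
      Real.arctan (Real.sinh (Real.pi * T)) / Real.pi =
      ((lfunctionZeroCount χ₁ T : ℝ) - (2 * gammaArgPhase 1 T + T * Real.log q) / Real.pi) -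
        ((lfunctionZeroCount χ₀ T : ℝ) - (2 * gammaArgPhase 0 T + T * Real.log q) / Real.pi) := by
    rw [← hm]; ring
  rw [key]
  calc |((lfunctionZeroCount χ₁ T : ℝ) - (2 * gammaArgPhase 1 T + T * Real.log q) / Real.pi) -
        ((lfunctionZeroCount χ₀ T : ℝ) - (2 * gammaArgPhase 0 T + T * Real.log q) / Real.pi)|
      ≤ |(lfunctionZeroCount χ₁ T : ℝ) - (2 * gammaArgPhase 1 T + T * Real.log q) / Real.pi| +
        |(lfunctionZeroCount χ₀ T : ℝ) - (2 * gammaArgPhase 0 T + T * Real.log q) / Real.pi| := abs_sub _ _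
    _ ≤ (5 + 2 * (Real.log (2 * (q * (T + 4) * Zc)) / Real.log (7 / 6))) +
        (5 + 2 * (Real.log (2 * (q * (T + 4) * Zc)) / Real.log (7 / 6))) := add_le_add a₁ a₀
    _ = 10 + 4 * (Real.log (2 * (q * (T + 4) * Zc)) / Real.log (7 / 6)) := by ring

/-! ### Stirling for the odd phase, transferred from `θ` -/

omit [NeZero q] in
/-- **Explicit first-order Stirling bracket for `θ₁`** (transfer of `abs_riemannSiegelTheta_sub_stirlingMain_le`
through `θ₁ = θ + ½ arctan(sinh πT)`): for `t ≥ 1`,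
`|θ₁(t) − ((t/2) log(t/2π) − t/2) − C₁ − π/4| ≤ 2 log t + π/4` with `C₁ = θ(1) − (½ log(1/2π) − ½)`;
i.e. `θ₁(t) = (t/2) log(t/2π) − t/2 + O(log t)` with the constants of the `ζ` file
(MV Corollary 14.6 at `κ = 1`: the constant is `+π/8` in place of `−π/8`).
[cite: MontgomeryVaughan2007, Corollary 14.6] -/
theorem abs_gammaArgPhase_one_sub_stirlingMain_le {t : ℝ} (ht : 1 ≤ t) :
    |gammaArgPhase 1 t - (t / 2 * Real.log (t / (2 * π)) - t / 2)
      - (riemannSiegelTheta 1 - (1 / 2 * Real.log (1 / (2 * π)) - 1 / 2)) - Real.pi / 4| ≤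
      2 * Real.log t + Real.pi / 4 := by
  have h0 := abs_riemannSiegelTheta_sub_stirlingMain_le ht
  rw [gammaArgPhase_one_eq_riemannSiegelTheta_add]
  set A := Real.arctan (Real.sinh (Real.pi * t)) / 2 with hA
  have hA1 : 0 ≤ A := by
    have hs : 0 ≤ Real.sinh (Real.pi * t) := Real.sinh_nonneg_iff.2 (by positivity)
    have : 0 ≤ Real.arctan (Real.sinh (Real.pi * t)) := by
      rw [← Real.arctan_zero]; exact Real.arctan_strictMono.monotone hs
    rw [hA]; linarith
  have hA2 : A < Real.pi / 4 := by
    have := Real.arctan_lt_pi_div_two (Real.sinh (Real.pi * t)); rw [hA]; linarith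
  set D := riemannSiegelTheta t - (t / 2 * Real.log (t / (2 * π)) - t / 2)
      - (riemannSiegelTheta 1 - (1 / 2 * Real.log (1 / (2 * π)) - 1 / 2)) with hD
  have e : riemannSiegelTheta t + A - (t / 2 * Real.log (t / (2 * π)) - t / 2)
      - (riemannSiegelTheta 1 - (1 / 2 * Real.log (1 / (2 * π)) - 1 / 2)) - Real.pi / 4 =
      D + (A - Real.pi / 4) := by rw [hD]; ring
  rw [e]
  have hB : |A - Real.pi / 4| ≤ Real.pi / 4 := by
    rw [abs_le]; constructor <;> linarith
  calc |D + (A - Real.pi / 4)| ≤ |D| + |A - Real.pi / 4| := abs_add_le _ _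
    _ ≤ 2 * Real.log t + Real.pi / 4 := add_le_add h0 hB


/-! ### MV Corollary 14.6 for the odd phase with an explicit constant -/

/-- The parity correction is exponentially close to `π/4`:
`0 ≤ π/4 − ½ arctan(sinh πt) = ½ arctan(1/sinh πt) ≤ 1/(2 sinh πt)` for `t > 0`
(`arctan y < y` for `y > 0`). [cite: MontgomeryVaughan2007, Corollary 14.6 (the O(1/(T+1)) term)] -/
theorem pi_div_four_sub_half_arctan_sinh_mem_Icc {t : ℝ} (ht : 0 < t) :
    Real.pi / 4 - Real.arctan (Real.sinh (Real.pi * t)) / 2 ∈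
      Icc (0 : ℝ) (1 / (2 * Real.sinh (Real.pi * t))) := by
  have hs : 0 < Real.sinh (Real.pi * t) := Real.sinh_pos_iff.2 (by positivity)
  have hinv := Real.arctan_inv_of_pos hs
  have h1 : 0 < Real.arctan (Real.sinh (Real.pi * t))⁻¹ := by
    rw [← Real.arctan_zero]; exact Real.arctan_strictMono (inv_pos.2 hs)
  have h2 : Real.arctan (Real.sinh (Real.pi * t))⁻¹ < (Real.sinh (Real.pi * t))⁻¹ := by
    have hlt := Real.lt_tan h1 (Real.arctan_lt_pi_div_two _)
    rwa [Real.tan_arctan] at hlt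
  have e : Real.pi / 4 - Real.arctan (Real.sinh (Real.pi * t)) / 2 =
      Real.arctan (Real.sinh (Real.pi * t))⁻¹ / 2 := by rw [hinv]; ring
  rw [e, mem_Icc]
  constructor
  · linarith
  · have e2 : (1 : ℝ) / (2 * Real.sinh (Real.pi * t)) = (Real.sinh (Real.pi * t))⁻¹ / 2 := by
      field_simp
    rw [e2]
    linarith [h2.le]

/-- **MV Corollary 14.6 at `κ = 1`, explicit**: for `t ≥ 2`,
`|θ₁(t) − ((t/2) log(t/2π) − t/2 + π/8)| ≤ 2K(¼)/t + 1/(2 sinh πt)`, `K = stirlingVertRate`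
(the tree's explicit Stirling bound for `θ` with constant `−π/8`, transferred through
`θ₁ = θ + ½ arctan(sinh πt)`; MV: `θ_κ(T) = (T/2) log(T/2π) − T/2 − π χ(−1)/8 + O(1/(T+1))`).
[cite: MontgomeryVaughan2007, Corollary 14.6 (pp. 455–456)] -/
theorem abs_gammaArgPhase_one_sub_stirling_le {t : ℝ} (ht : 2 ≤ t) :
    |gammaArgPhase 1 t - (t / 2 * Real.log (t / (2 * π)) - t / 2 + Real.pi / 8)| ≤
      2 * stirlingVertRate (1 / 4) / t + 1 / (2 * Real.sinh (Real.pi * t)) := by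
  have h0 := abs_riemannSiegelTheta_sub_stirling_le ht
  have hc := pi_div_four_sub_half_arctan_sinh_mem_Icc (show 0 < t by linarith)
  rw [gammaArgPhase_one_eq_riemannSiegelTheta_add]
  set A := Real.arctan (Real.sinh (Real.pi * t)) / 2 with hA
  set D := riemannSiegelTheta t - (t / 2 * Real.log (t / (2 * π)) - t / 2 - π / 8) with hD
  have e : riemannSiegelTheta t + A - (t / 2 * Real.log (t / (2 * π)) - t / 2 + Real.pi / 8) =
      D - (Real.pi / 4 - A) := by rw [hD]; ring
  rw [e]
  have hB : |Real.pi / 4 - A| ≤ 1 / (2 * Real.sinh (Real.pi * t)) := by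
    rw [abs_of_nonneg hc.1]; exact hc.2
  calc |D - (Real.pi / 4 - A)| ≤ |D| + |Real.pi / 4 - A| := abs_sub _ _
    _ ≤ 2 * stirlingVertRate (1 / 4) / t + 1 / (2 * Real.sinh (Real.pi * t)) := add_le_add h0 hB

end DirichletTheta

end Literature.NumberTheory.LFunctions
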